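import Mathlib.Data.Real.Basic
import Mathlib.Algebra.Order.BigOperators.Group.Finset
import Mathlib.Algebra.BigOperators.Ring.Finset
import Mathlib.Algebra.Order.Field.Basic
import Mathlib.Tactic
import HarnessLib

/-!
# `NoHeavyLowerTail` (stmt-CriticalPhenomena-4575) — pure bookkeeping of the Kozma–Nitzan pushing schemes

Support file (prover `prim-lf-7`; `--supports stmt-CriticalPhenomena-4575`).  No definitions, no named facts, no sorries; no measure theory.

Abstract setting: a finite family of blocks `B` with weights `φ_B` (KN's conditional attachment probabilities) and increments `Δ_B`
(trace-pattern differences `m_B − m_{S∖B}`); the analytic input `slack(XZ_T) ≥ Σ_B φ_B Δ_B` lives in `…GiantKnKFold.lean`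
(`patternStep`).  Here: the finite-sum manipulations showing `Σ_B φ_B Δ_B ≥ 0` under the two pushing rules
`Σ_{x∈B} φ_{x} ≤ φ_B` (push positive mass down, KN Lemma 2) and `φ_B ≤ φ_{B'}` for `B ⊆ B'` (push negative mass up):
* `GiantKn.sum_split3` — singletons / proper blocks / top;
* `GiantKn.core_topAbsorbing` — the top-absorbing scheme (negative proper blocks absorbed by the top increment, everything else
  pushed to singletons, singleton coefficients telescope to `ℓ x = μ(L_c) − μ(L_x)`);
* `GiantKn.core_flow` — general flow certificates along a monotone relation.
Used by `GiantKn.xzT_of_topAbsorbing` / `GiantKn.xzT_of_knFlow` (`…GiantKnTopAbsorbing.lean`).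
-/

namespace Summit.CriticalPhenomena.PercolationContinuityZ3.Theorems

open scoped BigOperators

namespace GiantKn

section Core

variable {α : Type*} [DecidableEq α]

/-- Three-way split of a sum over a family of nonempty subsets of `T` containing `T` (`|T| ≥ 2`): singletons, proper blocks of
size `≥ 2`, and `T` itself. -/
theorem sum_split3 (T : Finset α) (hT2 : 2 ≤ T.card) (F : Finset (Finset α)) (hTF : T ∈ F) (hcard : ∀ B ∈ F, 1 ≤ B.card)
    (f : Finset α → ℝ) :
    ∑ B ∈ F, f B = ∑ B ∈ F.filter (fun B => B.card = 1), f B + ∑ B ∈ F.filter (fun B => 2 ≤ B.card ∧ B ≠ T), f B + f T := by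
  rw [← Finset.sum_filter_add_sum_filter_not F (fun B => B.card = 1)]
  have hT' : T ∈ F.filter (fun B => ¬ B.card = 1) := by rw [Finset.mem_filter]; exact ⟨hTF, by omega⟩
  rw [← Finset.add_sum_erase _ _ hT']
  have e : (F.filter (fun B => ¬ B.card = 1)).erase T = F.filter (fun B => 2 ≤ B.card ∧ B ≠ T) := by
    ext B
    simp only [Finset.mem_erase, Finset.mem_filter]
    constructor
    · rintro ⟨hne, hB, hc⟩; exact ⟨hB, by have := hcard B hB; omega, hne⟩
    · rintro ⟨hB, hc, hne⟩; exact ⟨hne, hB, by omega⟩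
  rw [e]; ring

/-- **The top-absorbing pushing scheme (pure bookkeeping behind `xzT_of_topAbsorbing`).**  For weights `φ` that are superadditive on
singletons (`Σ_{x∈B} φ{x} ≤ φ B`, KN Lemma 2), monotone towards the top (`φ B ≤ φ T`) and nonnegative on singletons, and increments `Δ` with
`Σ_{B ∋ x} Δ B = ℓ x`: if the top increment absorbs the negative parts of the proper blocks (`H1`) and each `ℓ x` absorbs the negative parts
of the proper blocks avoiding `x` (`H2`), then `Σ_{∅ ≠ B ⊆ T} φ B Δ B ≥ 0`. -/
theorem core_topAbsorbing (T : Finset α) (hT2 : 2 ≤ T.card) (φ Δ : Finset α → ℝ) (ℓ : α → ℝ)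
    (hφ0 : ∀ x ∈ T, 0 ≤ φ {x})
    (hL2 : ∀ B, B ⊆ T → ∑ x ∈ B, φ {x} ≤ φ B)
    (hmono : ∀ B, B ⊆ T → B.Nonempty → φ B ≤ φ T)
    (htel : ∀ x ∈ T, ∑ B ∈ T.powerset.filter (fun B => x ∈ B), Δ B = ℓ x)
    (H1 : ∑ B ∈ T.powerset.filter (fun B => 2 ≤ B.card ∧ B ≠ T), max (-Δ B) 0 ≤ Δ T)
    (H2 : ∀ x ∈ T, ∑ B ∈ (T.powerset.filter (fun B => 2 ≤ B.card ∧ B ≠ T)).filter (fun B => x ∉ B), max (-Δ B) 0 ≤ ℓ x) :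
    0 ≤ ∑ B ∈ T.powerset.filter (fun B => B.Nonempty), φ B * Δ B := by
  set I := T.powerset.filter (fun B => B.Nonempty) with hI
  set I2 := T.powerset.filter (fun B => 2 ≤ B.card ∧ B ≠ T) with hI2
  set q : Finset α → ℝ := fun B => max (-Δ B) 0 with hq
  set p : Finset α → ℝ := fun B => Δ B + q B with hp
  set N' := ∑ B ∈ I2, q B with hN'
  have hTne : T.Nonempty := Finset.card_pos.1 (by omega)
  have hTI : T ∈ I := by rw [hI, Finset.mem_filter, Finset.mem_powerset]; exact ⟨subset_refl T, hTne⟩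
  have hq0 : ∀ B, 0 ≤ q B := fun B => le_max_right _ _
  have hp0 : ∀ B, 0 ≤ p B := fun B => by show 0 ≤ Δ B + max (-Δ B) 0; have := le_max_left (-Δ B) 0; linarith
  -- (S1) split the main sum
  have S1 : ∑ B ∈ I, φ B * Δ B = ∑ x ∈ T, φ {x} * Δ {x} + ∑ B ∈ I2, φ B * Δ B + φ T * Δ T := by
    rw [sum_split3 T hT2 I hTI (fun B hB => by
      rw [hI, Finset.mem_filter] at hB; exact Finset.card_pos.2 hB.2) (fun B => φ B * Δ B)]
    congr 1; congr 1
    · -- singletons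
      have e : I.filter (fun B => B.card = 1) = T.image (fun x => ({x} : Finset α)) := by
        ext B
        simp only [hI, Finset.mem_filter, Finset.mem_powerset, Finset.mem_image, Finset.card_eq_one]
        constructor
        · rintro ⟨⟨hBT, _⟩, ⟨x, rfl⟩⟩; exact ⟨x, hBT (Finset.mem_singleton_self x), rfl⟩
        · rintro ⟨x, hx, rfl⟩; exact ⟨⟨Finset.singleton_subset_iff.2 hx, Finset.singleton_nonempty x⟩, ⟨x, rfl⟩⟩
      rw [e, Finset.sum_image (fun x _ y _ h => Finset.singleton_injective h)]
    · have e : I.filter (fun B => 2 ≤ B.card ∧ B ≠ T) = I2 := by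
        ext B
        simp only [hI, hI2, Finset.mem_filter, Finset.mem_powerset]
        constructor
        · rintro ⟨⟨hBT, _⟩, h2, hne⟩; exact ⟨hBT, h2, hne⟩
        · rintro ⟨hBT, h2, hne⟩; exact ⟨⟨hBT, Finset.card_pos.1 (by omega)⟩, h2, hne⟩
      rw [e]
  -- (a) blocks: φ B Δ B ≥ (Σ φ{x}) p B − φ T q B
  have ha : ∀ B ∈ I2, (∑ x ∈ B, φ {x}) * p B - φ T * q B ≤ φ B * Δ B := by
    intro B hB
    rw [hI2, Finset.mem_filter, Finset.mem_powerset] at hB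
    have hBne : B.Nonempty := Finset.card_pos.1 (by omega)
    by_cases hs : 0 ≤ Δ B
    · have hqB : q B = 0 := by show max (-Δ B) 0 = 0; exact max_eq_right (by linarith)
      have hpB : p B = Δ B := by show Δ B + q B = Δ B; rw [hqB, add_zero]
      rw [hqB, hpB, mul_zero, sub_zero]
      exact mul_le_mul_of_nonneg_right (hL2 B hB.1) hs
    · push Not at hs
      have hqB : q B = -Δ B := by show max (-Δ B) 0 = -Δ B; exact max_eq_left (by linarith)
      have hpB : p B = 0 := by show Δ B + q B = 0; rw [hqB]; ring
      rw [hqB, hpB, mul_zero, zero_sub]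
      have := hmono B hB.1 hBne
      nlinarith
  -- (S3) swap
  have S3 : ∑ B ∈ I2, (∑ x ∈ B, φ {x}) * p B = ∑ x ∈ T, φ {x} * ∑ B ∈ I2.filter (fun B => x ∈ B), p B := by
    have e1 : ∀ B ∈ I2, (∑ x ∈ B, φ {x}) * p B = ∑ x ∈ T, (if x ∈ B then φ {x} * p B else 0) := by
      intro B hB
      rw [hI2, Finset.mem_filter, Finset.mem_powerset] at hB
      rw [Finset.sum_mul, ← Finset.sum_filter]
      congr 1
      ext y; simp only [Finset.mem_filter]; exact ⟨fun h => ⟨hB.1 h, h⟩, fun h => h.2⟩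
    rw [Finset.sum_congr rfl e1, Finset.sum_comm]
    refine Finset.sum_congr rfl fun x _ => ?_
    rw [Finset.mul_sum, ← Finset.sum_filter]
  -- (S2) telescoping split: ℓ x = Δ{x} + Σ_{B ∈ I2, x ∈ B} Δ B + Δ T
  have S2 : ∀ x ∈ T, ℓ x = Δ {x} + ∑ B ∈ I2.filter (fun B => x ∈ B), Δ B + Δ T := by
    intro x hx
    rw [← htel x hx]
    have hTF : T ∈ T.powerset.filter (fun B => x ∈ B) := by
      rw [Finset.mem_filter, Finset.mem_powerset]; exact ⟨subset_refl T, hx⟩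
    rw [sum_split3 T hT2 _ hTF (fun B hB => by
      rw [Finset.mem_filter] at hB; exact Finset.card_pos.2 ⟨x, hB.2⟩) Δ]
    congr 1; congr 1
    · have e : (T.powerset.filter (fun B => x ∈ B)).filter (fun B => B.card = 1) = {({x} : Finset α)} := by
        ext B
        simp only [Finset.mem_filter, Finset.mem_powerset, Finset.mem_singleton, Finset.card_eq_one]
        constructor
        · rintro ⟨⟨_, hxB⟩, ⟨y, rfl⟩⟩; rw [Finset.mem_singleton] at hxB; rw [hxB]
        · rintro rfl; exact ⟨⟨Finset.singleton_subset_iff.2 hx, Finset.mem_singleton_self x⟩, ⟨x, rfl⟩⟩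
      rw [e, Finset.sum_singleton]
    · have e : (T.powerset.filter (fun B => x ∈ B)).filter (fun B => 2 ≤ B.card ∧ B ≠ T) = I2.filter (fun B => x ∈ B) := by
        ext B
        simp only [hI2, Finset.mem_filter, Finset.mem_powerset]
        tauto
      rw [e]
  -- (S4) N' split by x ∈ B / x ∉ B
  have S4 : ∀ x : α, N' = ∑ B ∈ I2.filter (fun B => x ∈ B), q B + ∑ B ∈ I2.filter (fun B => x ∉ B), q B := by
    intro x; rw [hN', Finset.sum_filter_add_sum_filter_not]
  -- assemble
  have top : (∑ x ∈ T, φ {x}) * (Δ T - N') ≤ φ T * Δ T - φ T * N' := by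
    have h1 : 0 ≤ Δ T - N' := by linarith [H1]
    have := mul_le_mul_of_nonneg_right (hL2 T (subset_refl T)) h1
    nlinarith
  have blocks : ∑ B ∈ I2, ((∑ x ∈ B, φ {x}) * p B - φ T * q B) ≤ ∑ B ∈ I2, φ B * Δ B := Finset.sum_le_sum ha
  rw [Finset.sum_sub_distrib, ← Finset.mul_sum, S3] at blocks
  -- Σ_I φΔ ≥ Σ_x φ{x}Δ{x} + Σ_x φ{x} Σ_{I2∋x} p + (Σ_x φ{x})(Δ T − N')  = Σ_x φ{x}·bracket_x
  have brack : ∀ x ∈ T, 0 ≤ Δ {x} + ∑ B ∈ I2.filter (fun B => x ∈ B), p B + (Δ T - N') := by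
    intro x hx
    have hpsum : ∑ B ∈ I2.filter (fun B => x ∈ B), p B = ∑ B ∈ I2.filter (fun B => x ∈ B), Δ B + ∑ B ∈ I2.filter (fun B => x ∈ B), q B := by
      rw [← Finset.sum_add_distrib]
    rw [hpsum]
    have := S2 x hx
    have := S4 x
    have := H2 x hx
    linarith
  have final : 0 ≤ ∑ x ∈ T, φ {x} * (Δ {x} + ∑ B ∈ I2.filter (fun B => x ∈ B), p B + (Δ T - N')) :=
    Finset.sum_nonneg fun x hx => mul_nonneg (hφ0 x hx) (brack x hx)
  have expand : ∑ x ∈ T, φ {x} * (Δ {x} + ∑ B ∈ I2.filter (fun B => x ∈ B), p B + (Δ T - N')) =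
      ∑ x ∈ T, φ {x} * Δ {x} + ∑ x ∈ T, φ {x} * ∑ B ∈ I2.filter (fun B => x ∈ B), p B + (∑ x ∈ T, φ {x}) * (Δ T - N') := by
    rw [Finset.sum_mul, ← Finset.sum_add_distrib, ← Finset.sum_add_distrib]
    exact Finset.sum_congr rfl fun x _ => by ring
  rw [S1]
  linarith

end Core

section CoreFlow

variable {β : Type*}

/-- **Flow certificates (pure bookkeeping behind `xzT_of_knFlow`).**  On a finite index set `I` with weights `φ ≥ 0` that are monotone
along a relation `r` (`r B B' → φ B ≤ φ B'`), increments `Δ`, and a nonnegative flow `f B' B` from `B'` to `B` along `r B B'` whose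
out-flow at each `B'` is at most `(Δ B')⁺` and whose in-flow at each `B` is at least `(Δ B)⁻`:  `Σ_{B∈I} φ B Δ B ≥ 0`. -/
theorem core_flow (I : Finset β) (φ Δ : β → ℝ) (r : β → β → Prop) [DecidableRel r] (f : β → β → ℝ)
    (hφ0 : ∀ B ∈ I, 0 ≤ φ B) (hmono : ∀ B ∈ I, ∀ B' ∈ I, r B B' → φ B ≤ φ B') (hf : ∀ B' B, 0 ≤ f B' B)
    (hsup : ∀ B' ∈ I, ∑ B ∈ I.filter (fun B => r B B'), f B' B ≤ max (Δ B') 0)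
    (hdem : ∀ B ∈ I, max (-Δ B) 0 ≤ ∑ B' ∈ I.filter (fun B' => r B B'), f B' B) :
    0 ≤ ∑ B ∈ I, φ B * Δ B := by
  -- Δ = Δ⁺ − Δ⁻
  have hsplit : ∀ B, Δ B = max (Δ B) 0 - max (-Δ B) 0 := fun B => by
    rcases le_total 0 (Δ B) with h | h
    · rw [max_eq_left h, max_eq_right (by linarith)]; ring
    · rw [max_eq_right h, max_eq_left (by linarith)]; ring
  have h1 : ∑ B ∈ I, φ B * Δ B = ∑ B ∈ I, φ B * max (Δ B) 0 - ∑ B ∈ I, φ B * max (-Δ B) 0 := by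
    rw [← Finset.sum_sub_distrib]; exact Finset.sum_congr rfl fun B _ => by rw [← mul_sub, ← hsplit B]
  -- out-flow bound: Σ_{B'} φ B' Δ⁺ B' ≥ Σ_{B'} Σ_{B: r B B'} φ B' f B' B
  have hout : ∑ B' ∈ I, ∑ B ∈ I, (if r B B' then φ B' * f B' B else 0) ≤ ∑ B' ∈ I, φ B' * max (Δ B') 0 := by
    refine Finset.sum_le_sum fun B' hB' => ?_
    rw [← Finset.sum_filter, ← Finset.mul_sum]
    exact mul_le_mul_of_nonneg_left (hsup B' hB') (hφ0 B' hB')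
  -- in-flow bound: Σ_B φ B Δ⁻ B ≤ Σ_B Σ_{B': r B B'} φ B f B' B
  have hin : ∑ B ∈ I, φ B * max (-Δ B) 0 ≤ ∑ B ∈ I, ∑ B' ∈ I, (if r B B' then φ B * f B' B else 0) := by
    refine Finset.sum_le_sum fun B hB => ?_
    rw [← Finset.sum_filter, ← Finset.mul_sum]
    exact mul_le_mul_of_nonneg_left (hdem B hB) (hφ0 B hB)
  -- swap and compare termwise
  have hswap : ∑ B' ∈ I, ∑ B ∈ I, (if r B B' then φ B' * f B' B else 0) = ∑ B ∈ I, ∑ B' ∈ I, (if r B B' then φ B' * f B' B else 0) :=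
    Finset.sum_comm
  have hcmp : ∑ B ∈ I, ∑ B' ∈ I, (if r B B' then φ B * f B' B else 0) ≤ ∑ B ∈ I, ∑ B' ∈ I, (if r B B' then φ B' * f B' B else 0) := by
    refine Finset.sum_le_sum fun B hB => Finset.sum_le_sum fun B' hB' => ?_
    by_cases h : r B B'
    · rw [if_pos h, if_pos h]; exact mul_le_mul_of_nonneg_right (hmono B hB B' hB' h) (hf B' B)
    · rw [if_neg h, if_neg h]
  rw [h1]
  linarith

end CoreFlow

end GiantKn

end Summit.CriticalPhenomena.PercolationContinuityZ3.Theorems
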